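import Mathlib
import HarnessLib
import Summits.Ventures.LatticeQCDFlow.Scaling.GiniMeanDifferenceVarianceBounds
import Summits.Ventures.LatticeQCDFlow.Scaling.KurtosisIndependentSum

/-!
# LatticeQCDFlow / Scaling — the U(1) strong-coupling slope is pinned to `√V`:
# `√(V/12) ≤ s_V ≤ √(V/6)` for the untrained `V`-plaquette sampler

HONEST FRAMING: exact (Metropolis-corrected) sampling algorithms for lattice gauge theory;
figures of merit are autocorrelation/cost numbers at stated couplings and volumes; no
continuum-physics claim.

Venture `LatticeQCDFlow` (cell pub-lqcd), topic `Scaling`; FANOUT row 3 (`s0-u1-a`, S0-B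
implementation A, GEN-18).  NEW WORK of the cell (assembly), not a published result; NO definition is
introduced.  Parents (all in the tree): row 3's `Scaling/GiniMeanDifferenceVarianceBounds` (the
sandwich `√(Var/6) ≤ ½E|T − T′| ≤ √(Var/3)` at kurtosis `≤ 3`, `T` bounded below) and
`Scaling/KurtosisIndependentSum` (`Σᵢ cos θᵢ` under the product Haar probability: `E = 0`,
`E T² = V/2`, `E T⁴ ≤ 3(E T²)²`).

Setting: `V = #ι` plaquette angles, i.i.d. uniform on `(0, 2π]` (the Haar PROBABILITY
`(2π)⁻¹·Leb|(0,2π]` on each factor, `Measure.pi`), `T = Σᵢ cos θᵢ` (the factorised strong-coupling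
model of the U(1) action), and the HALF GINI MEAN DIFFERENCE `s_V = ½·E|T − T′|` of two independent
copies — by GEN-17 (D) `Scaling/IdentityFlowAcceptanceStrongCoupling` this is the strong-coupling
slope `lim_{β→0⁺} (1 − acc_V(β))/β` of the untrained exact sampler (that identification is NOT
restated here; this file is the measure-theoretic core, in the `Measure.pi` normalisation of
`Scaling/KurtosisIndependentSum`).

* `u1Pi_sum_cos_variance` — `Var T = V/2`; `u1Pi_sum_cos_centralFourth_le` — `E(T − ET)⁴ ≤ 3(Var T)²`;
* **`u1Pi_slope_ge_sqrt_card_div_twelve`** — `√(V/12) ≤ s_V` (Lyapunov at kurtosis `≤ 3`);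
* **`u1Pi_slope_le_sqrt_card_div_six`** — `s_V ≤ √(V/6)` (Glasser; GEN-17 (N)'s bound was `√V/2`);
* **`u1Pi_slope_volume_sandwich`** — both: `s_V/√V ∈ [1/√12, 1/√6] ≈ [0.289, 0.408]` for EVERY
  `V ≥ 1` (at `V = 1` the exact value is `4/π² ≈ 0.405`, `Scaling/CosineGiniConstant`).

Reading (value-free): the first-order acceptance loss per unit coupling of the untrained U(1)
sampler grows like `√V` with constants pinned within a factor `√2`; the acceptance at small `β` is
`1 − s_V β + o(β)` with `s_V ≍ √V`.  NOT CLAIMED: the limit `s_V/√V → 1/√π` (CLT); the torus (only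
the factorised model); any value at the cell's `(β, L)`; nothing re-scored.
-/

noncomputable section

namespace Summit.Ventures.LatticeQCDFlow.Theory2

open MeasureTheory ProbabilityTheory Finset Real Set

variable {ι : Type*} [Fintype ι]

/-- `Var(Σᵢ cos θᵢ) = V/2` under the product Haar probability. [ours] -/
theorem u1Pi_sum_cos_variance :
    variance (fun x : ι → ℝ => ∑ i, Real.cos (x i))
        (Measure.pi fun _ : ι => (ENNReal.ofReal (2 * π))⁻¹ • volume.restrict (Ioc (0 : ℝ) (2 * π)))
      = Fintype.card ι / 2 := by
  haveI : IsProbabilityMeasure ((ENNReal.ofReal (2 * π))⁻¹ • volume.restrict (Ioc (0 : ℝ) (2 * π))) :=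
    ⟨by rw [Measure.smul_apply, Measure.restrict_apply_univ, Real.volume_Ioc, sub_zero, smul_eq_mul,
      ENNReal.inv_mul_cancel (ENNReal.ofReal_pos.2 (by positivity : (0 : ℝ) < 2 * π)).ne'
        ENNReal.ofReal_ne_top]⟩
  obtain ⟨hL, h0, h2, -⟩ := u1_sum_cos_fourth_moment_le (ι := ι)
  rw [variance_eq_sub (hL.mono_exponent (by norm_num)), h0]
  simp only [Pi.pow_apply]
  rw [h2]
  ring

/-- `E(T − E T)⁴ ≤ 3·(Var T)²` for `T = Σᵢ cos θᵢ` under the product Haar probability (platykurtic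
sum, `Scaling/KurtosisIndependentSum`). [ours] -/
theorem u1Pi_sum_cos_centralFourth_le :
    ∫ x, ((∑ i, Real.cos (x i)) - ∫ y, ∑ i, Real.cos (y i)
        ∂(Measure.pi fun _ : ι => (ENNReal.ofReal (2 * π))⁻¹ • volume.restrict (Ioc (0 : ℝ) (2 * π)))) ^ 4
        ∂(Measure.pi fun _ : ι => (ENNReal.ofReal (2 * π))⁻¹ • volume.restrict (Ioc (0 : ℝ) (2 * π)))
      ≤ 3 * (variance (fun x : ι → ℝ => ∑ i, Real.cos (x i))
        (Measure.pi fun _ : ι => (ENNReal.ofReal (2 * π))⁻¹ • volume.restrict (Ioc (0 : ℝ) (2 * π)))) ^ 2 := by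
  haveI : IsProbabilityMeasure ((ENNReal.ofReal (2 * π))⁻¹ • volume.restrict (Ioc (0 : ℝ) (2 * π))) :=
    ⟨by rw [Measure.smul_apply, Measure.restrict_apply_univ, Real.volume_Ioc, sub_zero, smul_eq_mul,
      ENNReal.inv_mul_cancel (ENNReal.ofReal_pos.2 (by positivity : (0 : ℝ) < 2 * π)).ne'
        ENNReal.ofReal_ne_top]⟩
  obtain ⟨hL, h0, h2, h4⟩ := u1_sum_cos_fourth_moment_le (ι := ι)
  rw [h0, u1Pi_sum_cos_variance]
  simp only [sub_zero]
  rw [h2] at h4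
  exact h4

/-- **`√(V/12) ≤ s_V`**: the half Gini mean difference of `Σᵢ cos θᵢ` under the product Haar
probability is at least `√(V/12)` (Lyapunov lower bound at kurtosis `≤ 3`, `Var = V/2`). [ours] -/
theorem u1Pi_slope_ge_sqrt_card_div_twelve :
    Real.sqrt (Fintype.card ι / 12)
      ≤ 1 / 2 * ∫ x, ∫ x', |∑ i, Real.cos (x i) - ∑ i, Real.cos (x' i)|
          ∂(Measure.pi fun _ : ι => (ENNReal.ofReal (2 * π))⁻¹ • volume.restrict (Ioc (0 : ℝ) (2 * π)))
          ∂(Measure.pi fun _ : ι => (ENNReal.ofReal (2 * π))⁻¹ • volume.restrict (Ioc (0 : ℝ) (2 * π))) := by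
  haveI : IsProbabilityMeasure ((ENNReal.ofReal (2 * π))⁻¹ • volume.restrict (Ioc (0 : ℝ) (2 * π))) :=
    ⟨by rw [Measure.smul_apply, Measure.restrict_apply_univ, Real.volume_Ioc, sub_zero, smul_eq_mul,
      ENNReal.inv_mul_cancel (ENNReal.ofReal_pos.2 (by positivity : (0 : ℝ) < 2 * π)).ne'
        ENNReal.ofReal_ne_top]⟩
  obtain ⟨hL, -, -, -⟩ := u1_sum_cos_fourth_moment_le (ι := ι)
  have hTm : Measurable fun x : ι → ℝ => ∑ i, Real.cos (x i) :=
    Finset.measurable_sum _ fun i _ => Real.measurable_cos.comp (measurable_pi_apply i)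
  have h := sqrt_variance_div_six_le_half_integral_abs_sub hTm hL u1Pi_sum_cos_centralFourth_le
  rw [u1Pi_sum_cos_variance] at h
  calc Real.sqrt (Fintype.card ι / 12) = Real.sqrt (Fintype.card ι / 2 / 6) := by
        rw [div_div]; norm_num
    _ ≤ _ := h

/-- **`s_V ≤ √(V/6)`**: the half Gini mean difference of `Σᵢ cos θᵢ` under the product Haar
probability is at most `√(V/6)` (Glasser's inequality, `T > −V − 1`). [ours] -/
theorem u1Pi_slope_le_sqrt_card_div_six :
    1 / 2 * ∫ x, ∫ x', |∑ i, Real.cos (x i) - ∑ i, Real.cos (x' i)|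
          ∂(Measure.pi fun _ : ι => (ENNReal.ofReal (2 * π))⁻¹ • volume.restrict (Ioc (0 : ℝ) (2 * π)))
          ∂(Measure.pi fun _ : ι => (ENNReal.ofReal (2 * π))⁻¹ • volume.restrict (Ioc (0 : ℝ) (2 * π)))
      ≤ Real.sqrt (Fintype.card ι / 6) := by
  haveI : IsProbabilityMeasure ((ENNReal.ofReal (2 * π))⁻¹ • volume.restrict (Ioc (0 : ℝ) (2 * π))) :=
    ⟨by rw [Measure.smul_apply, Measure.restrict_apply_univ, Real.volume_Ioc, sub_zero, smul_eq_mul,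
      ENNReal.inv_mul_cancel (ENNReal.ofReal_pos.2 (by positivity : (0 : ℝ) < 2 * π)).ne'
        ENNReal.ofReal_ne_top]⟩
  obtain ⟨hL, -, -, -⟩ := u1_sum_cos_fourth_moment_le (ι := ι)
  have hTm : Measurable fun x : ι → ℝ => ∑ i, Real.cos (x i) :=
    Finset.measurable_sum _ fun i _ => Real.measurable_cos.comp (measurable_pi_apply i)
  have hC : ∀ x : ι → ℝ, -(Fintype.card ι : ℝ) - 1 < ∑ i, Real.cos (x i) := fun x => by
    have h : -∑ _i : ι, (1 : ℝ) ≤ ∑ i, Real.cos (x i) := by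
      rw [← sum_neg_distrib]
      exact sum_le_sum fun i _ => Real.neg_one_le_cos _
    rw [sum_const, card_univ, nsmul_eq_mul, mul_one] at h
    linarith
  have h := half_integral_abs_sub_le_sqrt_variance_div_three hTm (hL.mono_exponent (by norm_num)) hC
  rw [u1Pi_sum_cos_variance] at h
  calc _ ≤ Real.sqrt (Fintype.card ι / 2 / 3) := h
    _ = Real.sqrt (Fintype.card ι / 6) := by rw [div_div]; norm_num

/-- **THE `√V` LAW OF THE U(1) STRONG-COUPLING SLOPE, BOTH SIDES**: `√(V/12) ≤ s_V ≤ √(V/6)` for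
every `V` — the slope of the untrained `V`-plaquette sampler is pinned to `√V` within the factor
`√2`. [ours] -/
theorem u1Pi_slope_volume_sandwich :
    Real.sqrt (Fintype.card ι / 12)
        ≤ 1 / 2 * ∫ x, ∫ x', |∑ i, Real.cos (x i) - ∑ i, Real.cos (x' i)|
            ∂(Measure.pi fun _ : ι => (ENNReal.ofReal (2 * π))⁻¹ • volume.restrict (Ioc (0 : ℝ) (2 * π)))
            ∂(Measure.pi fun _ : ι => (ENNReal.ofReal (2 * π))⁻¹ • volume.restrict (Ioc (0 : ℝ) (2 * π)))
      ∧ 1 / 2 * ∫ x, ∫ x', |∑ i, Real.cos (x i) - ∑ i, Real.cos (x' i)|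
            ∂(Measure.pi fun _ : ι => (ENNReal.ofReal (2 * π))⁻¹ • volume.restrict (Ioc (0 : ℝ) (2 * π)))
            ∂(Measure.pi fun _ : ι => (ENNReal.ofReal (2 * π))⁻¹ • volume.restrict (Ioc (0 : ℝ) (2 * π)))
          ≤ Real.sqrt (Fintype.card ι / 6) :=
  ⟨u1Pi_slope_ge_sqrt_card_div_twelve, u1Pi_slope_le_sqrt_card_div_six⟩

end Summit.Ventures.LatticeQCDFlow.Theory2

end
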